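import Mathlib.GroupTheory.SpecificGroups.Dihedral
import Mathlib.Tactic.Linarith
import Mathlib.Tactic.Ring
import Mathlib.Tactic.Positivity
import Literature.Combinatorics.Additive.TripleProductProperty
import Summits.MatrixMultiplication.OmegaCensus.DihedralTPPUpperBound
import HarnessLib

/-!
# The exact dihedral law `β(D_{2n}) = 4⌊2n/3⌋` for every `n ≢ 1 (mod 3)`

ω-census, family (b3).  Framing: lottery ticket; floor = certified bounds/negative ranges.

`DihedralTPPUpperBound.lean` proves `3|S||T||U| ≤ 8n` for every TPP triple of `D_{2n}`, which is the census's exact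
law `4⌊2n/3⌋` when `3 ∣ n` and exceeds it by `2` (`n ≡ 1`) or `1` (`n ≡ 2 (mod 3)`).  Here the integrality of the four
counting quantities `A₀, A₁, A₂, A₃` is exploited: an equality analysis of the Newton/AM-GM step shows
`3(A₀+A₁+A₂+A₃) = 8n − 1` is impossible (`core_int_ne`), so for `n ≡ 2 (mod 3)` the volume is `≤ (8n−4)/3 = 4⌊2n/3⌋`
(`tpp_volume_le_law_of_mod_three`).  With the kernel lower bound `dihedral_volume_ge_law` this gives the exact TPP
capacity `β(D_{2n}) = 4⌊2n/3⌋` for ALL `n ≥ 3` with `n ≢ 1 (mod 3)` (`dihedral_law_exact`).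

For `n ≡ 1 (mod 3)` the counting relaxation genuinely allows `4⌊2n/3⌋ + 2`, and exactly at the centred hexagonal
numbers `n = 3m²+3m+1` (seat notes: the size vector `(1,1),(m,m+1),(m+1,m)`); there the law is equivalent to a
finite tiling question in `ZMod n`, refuted for `n = 7, 19` by two independent searches, open from `n = 37` on.
-/

namespace Summit.MatrixMultiplication.OmegaCensus

open Literature.Combinatorics.Additive Finset DihedralGroup

/-! ## The integer core: `3 ΣAᵢ ≠ 8n − 1` -/

/-- Half of the equality analysis (`A₂ ≤ A₁`): integers `0 ≤ Aᵢ ≤ n` with `3A₀A₂ ≤ A₁²`, `3A₁A₃ ≤ A₂²` and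
`A₂ ≤ A₁` never have `3(A₀+A₁+A₂+A₃) = 8n − 1` unless `3A₀ ∈ {n−1, n}` — which `n ≡ 2 (mod 3)` excludes. [folklore] -/
theorem core_int_ne_aux (n A₀ A₁ A₂ A₃ : ℤ) (hA₀ : 0 ≤ A₀) (hA₁ : 0 ≤ A₁) (hA₂ : 0 ≤ A₂) (hA₃ : 0 ≤ A₃)
    (h₀ : A₀ ≤ n) (h₁ : A₁ ≤ n) (h₂ : A₂ ≤ n) (h₃ : A₃ ≤ n)
    (hN₁ : 3 * A₀ * A₂ ≤ A₁ ^ 2) (hN₂ : 3 * A₁ * A₃ ≤ A₂ ^ 2) (h21 : A₂ ≤ A₁) (hmod : n % 3 = 2)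
    (hV : 3 * (A₀ + A₁ + A₂ + A₃) = 8 * n - 1) : False := by
  have hn : 1 ≤ n := by linarith
  -- `A₁ > 0`
  rcases eq_or_lt_of_le hA₁ with h1 | hA1pos
  · have hA2z : A₂ = 0 := le_antisymm (h1 ▸ h21) hA₂
    subst hA2z
    rw [← h1] at hV
    linarith
  -- `3 A₃ ≤ A₂`
  have h33 : A₁ * (3 * A₃) ≤ A₁ * A₂ := by nlinarith [mul_le_mul_of_nonneg_left h21 hA₂]
  have hA3 : 3 * A₃ ≤ A₂ := le_of_mul_le_mul_left h33 hA1pos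
  -- `3 A₀ + 4 A₂ ≤ 5 n`
  have hsq : 3 * A₀ * A₂ ≤ n ^ 2 := by nlinarith
  have h54 : n * (3 * A₀ + 4 * A₂) ≤ n * (5 * n) := by
    nlinarith [mul_nonneg (sub_nonneg.2 h₂) (by linarith : (0:ℤ) ≤ 4 * n - 3 * A₀)]
  have h54' : 3 * A₀ + 4 * A₂ ≤ 5 * n := le_of_mul_le_mul_left h54 (by linarith)
  -- hence `A₁ = n` and `3A₀ + 4A₂ ≥ 5n - 1`
  have hA1n : A₁ = n := by omega
  subst hA1n
  have hlow : 5 * A₁ - 1 ≤ 3 * A₀ + 4 * A₂ := by omega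
  rcases eq_or_lt_of_le h₂ with h2n | h2lt
  · -- `A₂ = n`: then `3A₀ ∈ {n-1, n}`, impossible mod 3
    subst h2n
    have : 3 * A₃ ≤ A₂ := hA3
    omega
  · -- `A₂ ≤ n - 1`: the identity `n(5n − 3A₀ − 4A₂) = (n² − 3A₀A₂) + (n − A₂)(4n − 3A₀)` forces `A₀ = n`, parity
    have e : A₁ * (5 * A₁ - 3 * A₀ - 4 * A₂) = (A₁ ^ 2 - 3 * A₀ * A₂) + (A₁ - A₂) * (4 * A₁ - 3 * A₀) := by ring
    have hge : 4 * A₁ - 3 * A₀ ≤ (A₁ - A₂) * (4 * A₁ - 3 * A₀) := by nlinarith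
    have hone : A₁ * (5 * A₁ - 3 * A₀ - 4 * A₂) ≤ A₁ * 1 := by nlinarith
    have hA0n : A₀ = A₁ := by nlinarith
    -- with `A₀ = A₁ = n`, Newton's first inequality gives `3 A₂ ≤ n`, contradicting `4A₂ ≥ 2n - 1` unless `n ≤ 1`
    have h3A2 : 3 * A₂ ≤ A₁ := by
      by_contra hc
      push Not at hc
      nlinarith [mul_pos hA1pos (by linarith : (0:ℤ) < 3 * A₂ - A₁)]
    omega

/-- **Integer core.** Integers `0 ≤ Aᵢ ≤ n` with Newton's inequalities `3A₀A₂ ≤ A₁²`, `3A₁A₃ ≤ A₂²` and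
`n ≡ 2 (mod 3)` satisfy `3(A₀+A₁+A₂+A₃) ≠ 8n − 1` (both orderings of `A₁, A₂` via `core_int_ne_aux`). [folklore] -/
theorem core_int_ne (n A₀ A₁ A₂ A₃ : ℤ) (hA₀ : 0 ≤ A₀) (hA₁ : 0 ≤ A₁) (hA₂ : 0 ≤ A₂) (hA₃ : 0 ≤ A₃)
    (h₀ : A₀ ≤ n) (h₁ : A₁ ≤ n) (h₂ : A₂ ≤ n) (h₃ : A₃ ≤ n)
    (hN₁ : 3 * A₀ * A₂ ≤ A₁ ^ 2) (hN₂ : 3 * A₁ * A₃ ≤ A₂ ^ 2) (hmod : n % 3 = 2) :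
    3 * (A₀ + A₁ + A₂ + A₃) ≠ 8 * n - 1 := by
  intro hV
  rcases le_total A₂ A₁ with h | h
  · exact core_int_ne_aux n A₀ A₁ A₂ A₃ hA₀ hA₁ hA₂ hA₃ h₀ h₁ h₂ h₃ hN₁ hN₂ h hmod hV
  · exact core_int_ne_aux n A₃ A₂ A₁ A₀ hA₃ hA₂ hA₁ hA₀ h₃ h₂ h₁ h₀ (by linarith) (by linarith) h hmod (by linarith)

/-- Integer/natural core in the six coset-part sizes for `n ≡ 2 (mod 3)`: the four counting constraints give
`3(s₀+s₁)(t₀+t₁)(u₀+u₁) ≤ 8n − 2` (hence `≤ 8n − 4`). [folklore] -/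
theorem core_nat_mod_three (n s₀ s₁ t₀ t₁ u₀ u₁ : ℕ) (hmod : n % 3 = 2) (h₀ : s₀ * t₀ * u₀ ≤ n)
    (h₃ : s₁ * t₁ * u₁ ≤ n) (h₁ : s₁ * t₀ * u₀ + s₀ * t₁ * u₀ + s₀ * t₀ * u₁ ≤ n)
    (h₂ : s₀ * t₁ * u₁ + s₁ * t₀ * u₁ + s₁ * t₁ * u₀ ≤ n) :
    3 * ((s₀ + s₁) * (t₀ + t₁) * (u₀ + u₁)) + 2 ≤ 8 * n := by
  have hle := core_nat n s₀ s₁ t₀ t₁ u₀ u₁ h₀ h₃ h₁ h₂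
  set V : ℕ := (s₀ + s₁) * (t₀ + t₁) * (u₀ + u₁) with hVdef
  -- it remains to exclude `3V = 8n - 1`
  suffices hne : (3 : ℤ) * (V : ℤ) ≠ 8 * n - 1 by omega
  set A₀ : ℤ := s₀ * t₀ * u₀ with hA₀
  set A₃ : ℤ := s₁ * t₁ * u₁ with hA₃
  set X : ℤ := s₁ * t₀ * u₀ with hX
  set Y : ℤ := s₀ * t₁ * u₀ with hY
  set Z : ℤ := s₀ * t₀ * u₁ with hZ
  set X' : ℤ := s₀ * t₁ * u₁ with hX'
  set Y' : ℤ := s₁ * t₀ * u₁ with hY'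
  set Z' : ℤ := s₁ * t₁ * u₀ with hZ'
  have q₀ : A₀ ≤ n := by rw [hA₀]; exact_mod_cast h₀
  have q₃ : A₃ ≤ n := by rw [hA₃]; exact_mod_cast h₃
  have q₁ : X + Y + Z ≤ n := by rw [hX, hY, hZ]; exact_mod_cast h₁
  have q₂ : X' + Y' + Z' ≤ n := by rw [hX', hY', hZ']; exact_mod_cast h₂
  have e₁ : A₀ * (X' + Y' + Z') = X * Y + Y * Z + Z * X := by
    simp only [hA₀, hX, hY, hZ, hX', hY', hZ']; ring
  have e₂ : (X + Y + Z) * A₃ = X' * Y' + Y' * Z' + Z' * X' := by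
    simp only [hA₃, hX, hY, hZ, hX', hY', hZ']; ring
  have eV : (3 : ℤ) * (V : ℤ) = 3 * (A₀ + (X + Y + Z) + (X' + Y' + Z') + A₃) := by
    simp only [hVdef, hA₀, hA₃, hX, hY, hZ, hX', hY', hZ']; push_cast; ring
  have hN₁ : 3 * A₀ * (X' + Y' + Z') ≤ (X + Y + Z) ^ 2 := by
    nlinarith [e₁, sq_nonneg (X - Y), sq_nonneg (Y - Z), sq_nonneg (Z - X)]
  have hN₂ : 3 * (X + Y + Z) * A₃ ≤ (X' + Y' + Z') ^ 2 := by
    nlinarith [e₂, sq_nonneg (X' - Y'), sq_nonneg (Y' - Z'), sq_nonneg (Z' - X')]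
  rw [eV]
  have hmod' : (n : ℤ) % 3 = 2 := by exact_mod_cast hmod
  exact core_int_ne n A₀ (X + Y + Z) (X' + Y' + Z') A₃ (by positivity) (by positivity) (by positivity)
    (by positivity) q₀ q₁ q₂ q₃ hN₁ hN₂ hmod'

/-! ## The dihedral law for `n ≡ 2 (mod 3)` and the exact law for `n ≢ 1 (mod 3)` -/

variable {n : ℕ} [NeZero n] {S T U : Finset (DihedralGroup n)}

/-- The four counting constraints on the coset parts of a TPP triple of `D_{2n}` (as in the proof of
`tpp_volume_le_dihedral`), packaged. [folklore] -/
theorem dihedral_parts_counting (h : TripleProductProperty S T U) :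
    (univ.filter fun i : ZMod n => r i ∈ S).card * (univ.filter fun i : ZMod n => r i ∈ T).card *
        (univ.filter fun i : ZMod n => r i ∈ U).card ≤ n ∧
    (univ.filter fun i : ZMod n => sr i ∈ S).card * (univ.filter fun i : ZMod n => sr i ∈ T).card *
        (univ.filter fun i : ZMod n => sr i ∈ U).card ≤ n ∧
    (univ.filter fun i : ZMod n => sr i ∈ S).card * (univ.filter fun i : ZMod n => r i ∈ T).card *
        (univ.filter fun i : ZMod n => r i ∈ U).card +
      (univ.filter fun i : ZMod n => r i ∈ S).card * (univ.filter fun i : ZMod n => sr i ∈ T).card *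
        (univ.filter fun i : ZMod n => r i ∈ U).card +
      (univ.filter fun i : ZMod n => r i ∈ S).card * (univ.filter fun i : ZMod n => r i ∈ T).card *
        (univ.filter fun i : ZMod n => sr i ∈ U).card ≤ n ∧
    (univ.filter fun i : ZMod n => r i ∈ S).card * (univ.filter fun i : ZMod n => sr i ∈ T).card *
        (univ.filter fun i : ZMod n => sr i ∈ U).card +
      (univ.filter fun i : ZMod n => sr i ∈ S).card * (univ.filter fun i : ZMod n => r i ∈ T).card *
        (univ.filter fun i : ZMod n => sr i ∈ U).card +
      (univ.filter fun i : ZMod n => sr i ∈ S).card * (univ.filter fun i : ZMod n => sr i ∈ T).card *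
        (univ.filter fun i : ZMod n => r i ∈ U).card ≤ n := by
  set S₀ : Finset (ZMod n) := univ.filter fun i => r i ∈ S with hS₀
  set S₁ : Finset (ZMod n) := univ.filter fun i => sr i ∈ S with hS₁
  set T₀ : Finset (ZMod n) := univ.filter fun i => r i ∈ T with hT₀
  set T₁ : Finset (ZMod n) := univ.filter fun i => sr i ∈ T with hT₁
  set U₀ : Finset (ZMod n) := univ.filter fun i => r i ∈ U with hU₀
  set U₁ : Finset (ZMod n) := univ.filter fun i => sr i ∈ U with hU₁
  have mS₀ : ∀ a ∈ S₀, cond false (sr a) (r a) ∈ S := fun a ha => by simpa [hS₀] using ha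
  have mS₁ : ∀ a ∈ S₁, cond true (sr a) (r a) ∈ S := fun a ha => by simpa [hS₁] using ha
  have mT₀ : ∀ a ∈ T₀, cond false (sr a) (r a) ∈ T := fun a ha => by simpa [hT₀] using ha
  have mT₁ : ∀ a ∈ T₁, cond true (sr a) (r a) ∈ T := fun a ha => by simpa [hT₁] using ha
  have mU₀ : ∀ a ∈ U₀, cond false (sr a) (r a) ∈ U := fun a ha => by simpa [hU₀] using ha
  have mU₁ : ∀ a ∈ U₁, cond true (sr a) (r a) ∈ U := fun a ha => by simpa [hU₁] using ha
  have hn : ∀ A : Finset (ZMod n), A.card ≤ n := fun A => by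
    simpa only [ZMod.card] using card_le_univ A
  refine ⟨?_, ?_, ?_, ?_⟩
  · rw [← card_sumset h false false false mS₀ mT₀ mU₀]; exact hn _
  · rw [← card_sumset h true true true mS₁ mT₁ mU₁]; exact hn _
  · rw [← card_sumset h true false false mS₁ mT₀ mU₀, ← card_sumset h false true false mS₀ mT₁ mU₀,
      ← card_sumset h false false true mS₀ mT₀ mU₁,
      ← card_union_of_disjoint (disjoint_sumset₁ h false mS₁ mT₀ mU₀ mS₀ mT₁),
      ← card_union_of_disjoint (disjoint_union_left.2
        ⟨(disjoint_sumset₃ h false mS₀ mT₀ mU₁ mS₁ mU₀).symm, disjoint_sumset₂ h false mS₀ mT₁ mU₀ mS₀ mT₀ mU₁⟩)]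
    exact hn _
  · rw [← card_sumset h false true true mS₀ mT₁ mU₁, ← card_sumset h true false true mS₁ mT₀ mU₁,
      ← card_sumset h true true false mS₁ mT₁ mU₀,
      ← card_union_of_disjoint (disjoint_sumset₁ h true mS₁ mT₀ mU₁ mS₀ mT₁).symm,
      ← card_union_of_disjoint (disjoint_union_left.2
        ⟨disjoint_sumset₃ h true mS₀ mT₁ mU₁ mS₁ mU₀, (disjoint_sumset₂ h true mS₁ mT₁ mU₀ mS₁ mT₀ mU₁).symm⟩)]
    exact hn _

/-- **Dihedral law for `n ≡ 2 (mod 3)`.** Every TPP triple of `D_{2n}` with `n ≡ 2 (mod 3)` has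
`3|S||T||U| + 2 ≤ 8n`, i.e. `|S||T||U| ≤ 4⌊2n/3⌋`. [folklore] -/
theorem tpp_volume_le_of_mod_three_eq_two (hmod : n % 3 = 2) (h : TripleProductProperty S T U) :
    3 * (S.card * T.card * U.card) + 2 ≤ 8 * n := by
  obtain ⟨h₀, h₃, h₁, h₂⟩ := dihedral_parts_counting h
  rw [card_eq_parts S, card_eq_parts T, card_eq_parts U]
  exact core_nat_mod_three n _ _ _ _ _ _ hmod h₀ h₃ h₁ h₂

/-- **The law value for `n ≢ 1 (mod 3)`.** Every TPP triple of `D_{2n}`, `n % 3 ≠ 1`, has `|S||T||U| ≤ 4⌊2n/3⌋`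
(`3 ∣ n`: `tpp_volume_le_law_of_three_dvd`; `n ≡ 2`: `tpp_volume_le_of_mod_three_eq_two`). [folklore] -/
theorem tpp_volume_le_law_of_mod_three (hmod : n % 3 ≠ 1) (h : TripleProductProperty S T U) :
    S.card * T.card * U.card ≤ 4 * (2 * n / 3) := by
  have h8 := tpp_volume_le_dihedral h
  rcases Nat.lt_or_ge (n % 3) 1 with h0 | h0
  · omega
  · have h2 : n % 3 = 2 := by omega
    have := tpp_volume_le_of_mod_three_eq_two h2 h
    omega

/-- **Exact dihedral law for `n ≢ 1 (mod 3)`, `n ≥ 3`: `β(D_{2n}) = 4⌊2n/3⌋`** — every TPP triple has volume at most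
`4⌊2n/3⌋`, and the uniform family of `DihedralTPPFamilyAllN.lean` (`dihedral_volume_ge_law`) attains it. [folklore] -/
theorem dihedral_law_exact (hn : 3 ≤ n) (hmod : n % 3 ≠ 1) :
    (∀ S T U : Finset (DihedralGroup n), TripleProductProperty S T U → S.card * T.card * U.card ≤ 4 * (2 * n / 3)) ∧
    ∃ S T U : Finset (DihedralGroup n), TripleProductProperty S T U ∧ S.card * T.card * U.card = 4 * (2 * n / 3) := by
  refine ⟨fun S T U h => tpp_volume_le_law_of_mod_three hmod h, ?_⟩
  obtain ⟨S, T, U, h, -, -, -, hvol⟩ := dihedral_volume_ge_law n hn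
  exact ⟨S, T, U, h, hvol⟩

end Summit.MatrixMultiplication.OmegaCensus
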